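import Mathlib
import Literature.MathematicalPhysics.QuantumLattice.WilsonDiracAP
import Summits.QuantumFields.QCD.Theorems.QuarksAsStableActionCriticalLineDiamagnetismStubBlockReductionAux
import Summits.QuantumFields.QCD.Theorems.WilsonQuarkChessboardFlatCellOptimalStubGaugeCoerciveAllN
import Summits.QuantumFields.QCD.Theorems.WilsonQuarkChessboardFlatCellOptimalStubWardKernelAllN
import Summits.QuantumFields.QCD.Theorems.WilsonQuarkChessboardFlatCellOptimalStubBlockHessianFormulaAllN

/-!
# Reduction of the block margin to a per-momentum quadratic-form inequality, `N` colours
(helper for crux stmt-QuantumFields-9307 `FlatCellOptimal`, line `registered`, stub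
`stub_hessianMarginAllN`, sub-goal `stub_blockReductionAllN` — the `Fin 3 ↦ Fin N` port of the
sibling crux stmt-QuantumFields-9734's `…CriticalLineDiamagnetismStubBlockReduction`, gap G2a, wave 6)

What.  On the `2⁴` block `(ℤ/2)⁴` (colour `Fin N`, ANY `N : ℕ`, spin `Fin 4`) with constant central
link phases `u_μ = e^{iθ_μ}·1 ∈ U(N)`, `θ ∈ (0,π)⁴`, free `r = 1`, `m = 0` Wilson–Dirac operator `B⁰`
and hopping perturbation `Δ(Y)`, the one-loop block Hessian
`Q(Y) = ½ Re tr (B⁰⁻¹ΔY B⁰⁻¹ΔY) − ½ Re tr (B⁰⁻¹Δ(Y⋆Y))` dominates `γ` times the cell Wilson form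
`𝒦(Y) = Σ_{x,i<j} ‖Y(x,i) + Y(x+î,j) − Y(x+ĵ,i) − Y(x,j)‖²_F` on tiling-odd anti-Hermitian link
fields `Y : Edge 4 2 → M_N(ℂ)`, as soon as every momentum block `H(s)` of the (`N`-free)
block-Hessian kernel (`…StubBlockHessianFormulaAllN`) satisfies the quadratic-form inequality
`64 γ n_s |y|² ≤ yᵀ H(s) y` on real `4`-vectors `y` supported on the active set `{μ : s_μ = 1}`
(size `n_s`) and summing to zero (`stub_blockReductionAllN`; the sibling's `stub_blockReduction`
is the case `N = 3`).  The statement is the sibling's with `Fin 3 ↦ Fin N` (colour sums over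
`a b : Fin N`) and with the `let`s `B0, Dl, Mw, h, S, V, mom, qv, H` turned into universally
quantified variables with defining equations, so that the registered signature contains no `:=`.
The constant `64` and the hypothesis on `H(s)` are `N`-free, so the certified scalar block margins
of the sibling (CheckerCert0–3) and the `M = 4` certificate apply verbatim for every `N`.

How (verbatim the sibling's argument with `Fin 3 ↦ Fin N`; abstract form `BlockReduction.main`).
* Coulomb gauge: with the anti-Hermitian generator `λ(x) = Σ_s (χ_s(x)/(32 n_s)) Σ_μ Ŷ_μ(s)`, the
  gauged field `Y' = Y − dλ` has Walsh components `Ŷ'_μ(s)` supported on the active directions and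
  summing to zero, and `𝒦(Y) = ¼ Σ_s n_s Σ_μ ‖Ŷ'_μ(s)‖²_F` (the colour-free real scalar core
  `stub_blockReductionAux` of the sibling, applied to the real and imaginary parts of every colour
  entry `(a, b) ∈ Fin N × Fin N`).
* Ward: `Q(Y') = Q(Y)` — the polar form of `Q` kills gauge modes (`stub_wardKernelAllN`,
  additivity of `Δ`).
* Formula: `Q(Y') = (1/256) Σ_s Σ_{μν} H(s)_{μν} Re tr (Ŷ'_μ(s)ᴴ Ŷ'_ν(s))`
  (`BlockHessianFormula.blockHessian_eq` of `…StubBlockHessianFormulaAllN`; its hypothesis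
  `h(θ + πs') > 0` holds as `sin² θ₀ > 0`).
* `Re tr (Mᴴ M') = Σ_{ab} (Re M_{ab} Re M'_{ab} + Im M_{ab} Im M'_{ab})`, and the hypothesis is
  applied to the `2N²` real vectors `Re Ŷ'(s)_{ab}`, `Im Ŷ'(s)_{ab}` per class `s`; the Frobenius
  sums are split entrywise by the index-generic `GaugeCoercive.sum_frob_eq_re_im` of
  `…StubGaugeCoerciveAllN`.

Sources: Montvay–Münster, *Quantum Fields on a Lattice* §4.2 (Wilson fermions, hopping expansion,
gauge invariance of the fermion determinant); folklore (Walsh analysis on the hypercube).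
Pure theorem file (no `def`s).
-/

noncomputable section

open scoped BigOperators Classical Matrix ComplexConjugate
open Finset
open Literature.MathematicalPhysics.QuantumLattice Literature.MathematicalPhysics.QuantumFieldTheory
  Literature.Probability.LatticeModels

namespace Summit.QuantumFields.QCD.Cruxes.FlatCellOptimal.BlockReduction

open Complex (I)
open Summit.QuantumFields.QCD.Cruxes.CriticalLineDiamagnetism.ChessboardCellGain (stub_blockReductionAux)
open Summit.QuantumFields.QCD.Cruxes.FlatCellOptimal.BlockHessian (BlockHessianFormula.blockHessian_eq)
open Summit.QuantumFields.QCD.Cruxes.FlatCellOptimal.WardKernel (stub_wardKernelAllN)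

/-! ### Small pieces of linear algebra (`N` colours) -/

/-- `Re tr (Aᴴ B) = Σ_{ab} (Re A_{ab} Re B_{ab} + Im A_{ab} Im B_{ab})` for `N × N` complex matrices. -/
theorem re_trace_conjTranspose_mul {N : ℕ} (A B : Matrix (Fin N) (Fin N) ℂ) :
    ((Aᴴ * B).trace).re = ∑ a, ∑ b, ((A a b).re * (B a b).re + (A a b).im * (B a b).im) := by
  -- adapted from the sibling's `BlockReduction.re_trace_conjTranspose_mul` (`Fin 3 ↦ Fin N`)
  simp only [Matrix.trace, Matrix.diag, Matrix.mul_apply, Matrix.conjTranspose_apply,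
    Complex.star_def, Complex.re_sum, Complex.mul_re, Complex.conj_re, Complex.conj_im]
  rw [Finset.sum_comm]
  refine Finset.sum_congr rfl fun a _ => Finset.sum_congr rfl fun b _ => ?_
  ring

/-- Moving the colour indices `a b : Fin N` to the front of a momentum-block sum. -/
theorem sum_swap {N : ℕ} (F : Fin 4 → Fin 4 → Fin N → Fin N → ℝ) :
    ∑ μ, ∑ ν, ∑ a, ∑ b, F μ ν a b = ∑ a, ∑ b, ∑ μ, ∑ ν, F μ ν a b := by
  -- adapted from the sibling's `BlockReduction.sum_swap` (`Fin 3 ↦ Fin N`)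
  calc _ = ∑ μ, ∑ a, ∑ b, ∑ ν, F μ ν a b := Finset.sum_congr rfl fun μ _ => by
          rw [Finset.sum_comm]
          exact Finset.sum_congr rfl fun a _ => Finset.sum_comm
    _ = _ := by
          rw [Finset.sum_comm]
          exact Finset.sum_congr rfl fun a _ => Finset.sum_comm

/-! ### The reduction (abstract form, `N` colours) -/

section Main

variable {N : ℕ} (m : ℝ) (θ : Fin 4 → ℝ) (u : Fin 4 → Matrix.unitaryGroup (Fin N) ℂ)
  (B0 : Matrix (TorusSite 4 2 × Fin N × Fin 4) (TorusSite 4 2 × Fin N × Fin 4) ℂ)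
  (Dl : (Edge 4 2 → Matrix (Fin N) (Fin N) ℂ) →
    Matrix (TorusSite 4 2 × Fin N × Fin 4) (TorusSite 4 2 × Fin N × Fin 4) ℂ)
  (Mw h : (Fin 4 → ℝ) → ℝ) (S : (Fin 4 → ℝ) → Matrix (Fin 4) (Fin 4) ℂ)
  (V : (Fin 4 → ℝ) → (Fin 4 → ℝ) → Fin 4 → Matrix (Fin 4) (Fin 4) ℂ)
  (mom qv : (Fin 4 → ZMod 2) → Fin 4 → ℝ)
  (H : (Fin 4 → ZMod 2) → Fin 4 → Fin 4 → ℝ)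
  (chi : (Fin 4 → ZMod 2) → TorusSite 4 2 → ℝ)
  (Yh : (Edge 4 2 → Matrix (Fin N) (Fin N) ℂ) → (Fin 4 → ZMod 2) → Fin 4 → Matrix (Fin N) (Fin N) ℂ)

/-- **The reduction for `N` colours** (abstract form of `stub_blockReductionAllN`, any mass `m`): if
every momentum block `H(s)` satisfies `64 γ n_s |y|² ≤ yᵀ H(s) y` on real vectors supported on
`{μ : s_μ = 1}` and summing to zero, and the polarised Ward identity holds, then `γ 𝒦(Y) ≤ Q(Y)` for
every tiling-odd anti-Hermitian block link field `Y : Edge 4 2 → M_N(ℂ)`. -/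
theorem main
    (hθ : ∀ μ, 0 < θ μ ∧ θ μ < Real.pi)
    (hu : ∀ μ, (u μ : Matrix (Fin N) (Fin N) ℂ) = Complex.exp (↑(θ μ) * I) • (1 : Matrix (Fin N) (Fin N) ℂ))
    (hB0 : B0 = wilsonDirac (unitaryFundamentalRep (Fin N) ℂ) (fun e : Edge 4 2 => u e.2) m 1)
    (hDl : ∀ E, Dl E = Matrix.of fun p q : TorusSite 4 2 × Fin N × Fin 4 => -(1 / 2 : ℂ) * ∑ μ : Fin 4,
      ((if q.1 = Site.shift p.1 μ then ((1 : Matrix (Fin 4) (Fin 4) ℂ) - euclideanGamma μ) p.2.2 q.2.2 *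
          ((u μ : Matrix (Fin N) (Fin N) ℂ) * E (p.1, μ)) p.2.1 q.2.1 else 0) +
        (if p.1 = Site.shift q.1 μ then ((1 : Matrix (Fin 4) (Fin 4) ℂ) + euclideanGamma μ) p.2.2 q.2.2 *
          ((u μ : Matrix (Fin N) (Fin N) ℂ) * E (q.1, μ))ᴴ p.2.1 q.2.1 else 0)))
    (hMw : ∀ P, Mw P = m + ∑ κ, (1 - Real.cos (P κ)))
    (hh : ∀ P, h P = Mw P ^ 2 + ∑ κ, Real.sin (P κ) ^ 2)
    (hS : ∀ P, S P = ((h P)⁻¹ : ℂ) • (((Mw P : ℝ) : ℂ) • (1 : Matrix (Fin 4) (Fin 4) ℂ) -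
      I • ∑ κ, ((Real.sin (P κ) : ℝ) : ℂ) • euclideanGamma κ))
    (hV : ∀ P q μ, V P q μ = (-(1 / 2 : ℂ) * (Complex.exp (↑(P μ) * I) * I)) •
        ((1 : Matrix (Fin 4) (Fin 4) ℂ) - euclideanGamma μ) +
      (-(1 / 2 : ℂ) * (Complex.exp (-(↑(P μ + q μ) * I)) * (-I))) • ((1 : Matrix (Fin 4) (Fin 4) ℂ) + euclideanGamma μ))
    (hmom : ∀ s κ, mom s κ = θ κ + Real.pi * ((s κ).val : ℝ))
    (hqv : ∀ s κ, qv s κ = Real.pi * ((s κ).val : ℝ))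
    (hH : ∀ s μ ν, H s μ ν = (if μ = ν then (1 / 2 : ℝ) * ∑ s' : Fin 4 → ZMod 2,
        4 * (Real.sin (mom s' μ) ^ 2 - Mw (mom s') * Real.cos (mom s' μ)) / h (mom s') else 0) +
      (1 / 2 : ℝ) * (∑ s' : Fin 4 → ZMod 2, (S (mom s') * V (mom s' + qv s) (qv s) ν * S (mom s' + qv s) *
        V (mom s') (qv s) μ).trace).re)
    (hchi : ∀ s x, chi s x = (-1 : ℝ) ^ (∑ κ, (s κ).val * (x κ).val))
    (hYh : ∀ E s μ, Yh E s μ = ∑ x, ((chi s x : ℝ) : ℂ) • E (x, μ))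
    (hward : ∀ (Z : Edge 4 2 → Matrix (Fin N) (Fin N) ℂ) (lam : TorusSite 4 2 → Matrix (Fin N) (Fin N) ℂ),
      (∀ e, (Z e)ᴴ = -Z e) → (∀ x, (lam x)ᴴ = -lam x) →
        (B0⁻¹ * Dl Z * (B0⁻¹ * Dl (fun e => lam e.1 - lam (Site.shift e.1 e.2)))).trace.re =
          (B0⁻¹ * Dl (fun e => Z e * (lam e.1 - lam (Site.shift e.1 e.2)) +
            (lam e.1 - lam (Site.shift e.1 e.2)) * Z e)).trace.re / 2)
    (γ : ℝ)
    (hblock : ∀ (s : Fin 4 → ZMod 2) (y : Fin 4 → ℝ), (∀ μ, s μ = 0 → y μ = 0) → ∑ μ, y μ = 0 →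
      64 * γ * (((Finset.univ.filter (fun μ : Fin 4 => s μ = 1)).card : ℝ) * ∑ μ, y μ ^ 2) ≤
        ∑ μ, ∑ ν, H s μ ν * (y μ * y ν))
    (Y : Edge 4 2 → Matrix (Fin N) (Fin N) ℂ) (hY : ∀ e, (Y e)ᴴ = -Y e)
    (hodd : ∀ (x : TorusSite 4 2) (μ : Fin 4), Y (Site.shift x μ, μ) = -Y (x, μ)) :
    γ * (∑ p : Plaquette 4 2, ∑ a, ∑ b, ‖(Y (p.1, p.2.1.1) + Y (Site.shift p.1 p.2.1.1, p.2.1.2) -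
        Y (Site.shift p.1 p.2.1.2, p.2.1.1) - Y (p.1, p.2.1.2)) a b‖ ^ 2) ≤
      (B0⁻¹ * Dl Y * (B0⁻¹ * Dl Y)).trace.re / 2 - (B0⁻¹ * Dl (fun e => Y e * Y e)).trace.re / 2 := by
  -- adapted from the sibling's `BlockReduction.main` (`Fin 3 ↦ Fin N`)
  -- (0) the free symbol denominators are positive: `h(θ + πs') ≥ sin² θ₀ > 0`
  have hpos : ∀ s', 0 < h (mom s') := by
    intro s'
    have h1 : Real.sin (mom s' 0) ^ 2 = Real.sin (θ 0) ^ 2 := by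
      rw [hmom, mul_comm Real.pi, Real.sin_add_nat_mul_pi, mul_pow]
      rcases neg_one_pow_eq_or ℝ (s' 0).val with h' | h' <;> rw [h'] <;> norm_num
    have h2 : Real.sin (mom s' 0) ^ 2 ≤ ∑ κ, Real.sin (mom s' κ) ^ 2 :=
      Finset.single_le_sum (fun κ _ => sq_nonneg (Real.sin (mom s' κ))) (Finset.mem_univ 0)
    have h3 : 0 < Real.sin (θ 0) ^ 2 := pow_pos (Real.sin_pos_of_pos_of_lt_pi (hθ 0).1 (hθ 0).2) 2
    rw [hh]
    nlinarith [sq_nonneg (Mw (mom s'))]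
  -- (1) the Coulomb gauge generator and the gauged field
  obtain ⟨lam, hlam⟩ : ∃ lam : TorusSite 4 2 → Matrix (Fin N) (Fin N) ℂ, ∀ x, lam x =
      ∑ s, ((chi s x / (32 * ((Finset.univ.filter (fun μ : Fin 4 => s μ = 1)).card : ℝ)) : ℝ) : ℂ) •
        ∑ μ : Fin 4, ∑ y, ((chi s y : ℝ) : ℂ) • Y (y, μ) := ⟨_, fun _ => rfl⟩
  have hlam' : ∀ x, (lam x)ᴴ = -lam x := fun x => by
    simp only [hlam, Matrix.conjTranspose_sum, Matrix.conjTranspose_smul, Complex.star_def,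
      Complex.conj_ofReal, hY, smul_neg, Finset.sum_neg_distrib]
  obtain ⟨D, hD⟩ : ∃ D : Edge 4 2 → Matrix (Fin N) (Fin N) ℂ,
      ∀ e, D e = lam e.1 - lam (Site.shift e.1 e.2) := ⟨_, fun _ => rfl⟩
  have hDf : (fun e : Edge 4 2 => lam e.1 - lam (Site.shift e.1 e.2)) = D :=
    funext fun e => (hD e).symm
  have hDh : ∀ e, (D e)ᴴ = -D e := fun e => by
    rw [hD, Matrix.conjTranspose_sub, hlam', hlam']
    abel
  obtain ⟨Y', hY'⟩ : ∃ Y' : Edge 4 2 → Matrix (Fin N) (Fin N) ℂ, ∀ e, Y' e = Y e - D e :=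
    ⟨_, fun _ => rfl⟩
  have hY'h : ∀ e, (Y' e)ᴴ = -Y' e := fun e => by
    rw [hY', Matrix.conjTranspose_sub, hY, hDh]
    abel
  -- (2) Ward: `Q(Y') = Q(Y)`
  have hadd : ∀ E₁ E₂ : Edge 4 2 → Matrix (Fin N) (Fin N) ℂ, Dl (E₁ + E₂) = Dl E₁ + Dl E₂ := by
    intro E₁ E₂
    rw [hDl, hDl, hDl]
    ext p q
    simp only [Matrix.of_apply, Matrix.add_apply, Pi.add_apply, Matrix.mul_add,
      Matrix.conjTranspose_add]
    rw [← mul_add, ← Finset.sum_add_distrib]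
    congr 1
    refine Finset.sum_congr rfl fun μ _ => ?_
    split_ifs <;> ring
  have hsub : ∀ E₁ E₂ : Edge 4 2 → Matrix (Fin N) (Fin N) ℂ, Dl (E₁ - E₂) = Dl E₁ - Dl E₂ :=
    fun E₁ E₂ => eq_sub_of_add_eq (by rw [← hadd, sub_add_cancel])
  have w1 : (B0⁻¹ * Dl Y * (B0⁻¹ * Dl D)).trace.re =
      (B0⁻¹ * Dl (fun e => Y e * D e + D e * Y e)).trace.re / 2 := by
    have h1 := hward Y lam hY hlam'
    rw [hDf] at h1
    rw [h1]
    simp only [hD]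
  have w2 : (B0⁻¹ * Dl D * (B0⁻¹ * Dl D)).trace.re = (B0⁻¹ * Dl (fun e => D e * D e)).trace.re := by
    have h1 := hward D lam hDh hlam'
    rw [hDf] at h1
    have h2 : (fun e : Edge 4 2 => D e * (lam e.1 - lam (Site.shift e.1 e.2)) +
        (lam e.1 - lam (Site.shift e.1 e.2)) * D e) = (fun e => D e * D e) + fun e => D e * D e := by
      funext e
      simp only [← hD, Pi.add_apply]
    rw [h1, h2, hadd, Matrix.mul_add, Matrix.trace_add, Complex.add_re]
    ring
  have hQ : (B0⁻¹ * Dl Y' * (B0⁻¹ * Dl Y')).trace.re / 2 - (B0⁻¹ * Dl (fun e => Y' e * Y' e)).trace.re / 2 =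
      (B0⁻¹ * Dl Y * (B0⁻¹ * Dl Y)).trace.re / 2 - (B0⁻¹ * Dl (fun e => Y e * Y e)).trace.re / 2 := by
    have hY'f : Y' = Y - D := funext fun e => by rw [hY', Pi.sub_apply]
    have hsq : (fun e => Y' e * Y' e) =
        (fun e => Y e * Y e) - (fun e => Y e * D e + D e * Y e) + fun e => D e * D e := by
      funext e
      simp only [hY', Pi.add_apply, Pi.sub_apply, mul_sub, sub_mul]
      abel
    have hcomm : (B0⁻¹ * Dl D * (B0⁻¹ * Dl Y)).trace.re = (B0⁻¹ * Dl Y * (B0⁻¹ * Dl D)).trace.re := by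
      rw [Matrix.trace_mul_comm]
    rw [hsq, hY'f, hadd, hsub, hsub]
    simp only [Matrix.mul_sub, Matrix.sub_mul, Matrix.mul_add, Matrix.trace_sub, Matrix.trace_add,
      Complex.sub_re, Complex.add_re]
    linarith [hcomm, w1, w2]
  -- (3) the block-Hessian formula for the gauged field (all `N`)
  rw [← hQ, BlockHessianFormula.blockHessian_eq m θ u B0 Dl Mw h S V mom qv chi Yh Y' H hu hB0 hDl
    hMw hh hS hV hmom hqv hH hchi hYh hpos hY'h]
  -- (4) the Walsh components of the gauged field, entry by entry
  obtain ⟨R, hR⟩ : ∃ R : (Fin 4 → ZMod 2) → Fin 4 → Fin N → Fin N → ℝ,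
      ∀ s μ a b, R s μ a b = (Yh Y' s μ a b).re := ⟨_, fun _ _ _ _ => rfl⟩
  obtain ⟨J, hJ⟩ : ∃ J : (Fin 4 → ZMod 2) → Fin 4 → Fin N → Fin N → ℝ,
      ∀ s μ a b, J s μ a b = (Yh Y' s μ a b).im := ⟨_, fun _ _ _ _ => rfl⟩
  have auxR : ∀ a b, (∀ s μ, s μ = 0 → R s μ a b = 0) ∧ (∀ s, ∑ μ, R s μ a b = 0) ∧
      ∑ p : Plaquette 4 2, ((Y (p.1, p.2.1.1) + Y (Site.shift p.1 p.2.1.1, p.2.1.2) -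
        Y (Site.shift p.1 p.2.1.2, p.2.1.1) - Y (p.1, p.2.1.2)) a b).re ^ 2 =
      (1 / 4 : ℝ) * ∑ s : Fin 4 → ZMod 2, ((Finset.univ.filter (fun μ : Fin 4 => s μ = 1)).card : ℝ) *
        ∑ μ, R s μ a b ^ 2 := by
    intro a b
    have key := stub_blockReductionAux chi hchi (fun e => (Y e a b).re) (fun x μ => by simp [hodd])
      (fun x => (lam x a b).re) (fun x => by
        simp only [hlam, Matrix.sum_apply, Matrix.smul_apply, smul_eq_mul, Complex.re_sum,
          Complex.re_ofReal_mul])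
      (fun s μ => R s μ a b) (fun s μ => by
        simp only [hR, hYh, hY', hD, Matrix.sum_apply, Matrix.smul_apply, Matrix.sub_apply, smul_eq_mul,
          Complex.re_sum, Complex.re_ofReal_mul, Complex.sub_re])
    simpa only [Matrix.sub_apply, Matrix.add_apply, Complex.sub_re, Complex.add_re] using key
  have auxI : ∀ a b, (∀ s μ, s μ = 0 → J s μ a b = 0) ∧ (∀ s, ∑ μ, J s μ a b = 0) ∧
      ∑ p : Plaquette 4 2, ((Y (p.1, p.2.1.1) + Y (Site.shift p.1 p.2.1.1, p.2.1.2) -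
        Y (Site.shift p.1 p.2.1.2, p.2.1.1) - Y (p.1, p.2.1.2)) a b).im ^ 2 =
      (1 / 4 : ℝ) * ∑ s : Fin 4 → ZMod 2, ((Finset.univ.filter (fun μ : Fin 4 => s μ = 1)).card : ℝ) *
        ∑ μ, J s μ a b ^ 2 := by
    intro a b
    have key := stub_blockReductionAux chi hchi (fun e => (Y e a b).im) (fun x μ => by simp [hodd])
      (fun x => (lam x a b).im) (fun x => by
        simp only [hlam, Matrix.sum_apply, Matrix.smul_apply, smul_eq_mul, Complex.im_sum,
          Complex.im_ofReal_mul])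
      (fun s μ => J s μ a b) (fun s μ => by
        simp only [hJ, hYh, hY', hD, Matrix.sum_apply, Matrix.smul_apply, Matrix.sub_apply, smul_eq_mul,
          Complex.im_sum, Complex.im_ofReal_mul, Complex.sub_im])
    simpa only [Matrix.sub_apply, Matrix.add_apply, Complex.sub_im, Complex.add_im] using key
  -- (5) both sides entry by entry
  have hK : (∑ p : Plaquette 4 2, ∑ a, ∑ b, ‖(Y (p.1, p.2.1.1) + Y (Site.shift p.1 p.2.1.1, p.2.1.2) -
      Y (Site.shift p.1 p.2.1.2, p.2.1.1) - Y (p.1, p.2.1.2)) a b‖ ^ 2) =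
      ∑ a, ∑ b, ((1 / 4 : ℝ) * ∑ s : Fin 4 → ZMod 2,
          ((Finset.univ.filter (fun μ : Fin 4 => s μ = 1)).card : ℝ) * ∑ μ, R s μ a b ^ 2 +
        (1 / 4 : ℝ) * ∑ s : Fin 4 → ZMod 2,
          ((Finset.univ.filter (fun μ : Fin 4 => s μ = 1)).card : ℝ) * ∑ μ, J s μ a b ^ 2) := by
    rw [GaugeCoercive.sum_frob_eq_re_im]
    refine Finset.sum_congr rfl fun a _ => Finset.sum_congr rfl fun b _ => ?_
    rw [(auxR a b).2.2, (auxI a b).2.2]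
  have hRJ : ∑ s, ∑ μ, ∑ ν, H s μ ν * ((Yh Y' s μ)ᴴ * Yh Y' s ν).trace.re =
      ∑ s, ∑ a, ∑ b, ∑ μ, ∑ ν, H s μ ν * (R s μ a b * R s ν a b + J s μ a b * J s ν a b) := by
    refine Finset.sum_congr rfl fun s _ => ?_
    simp only [re_trace_conjTranspose_mul, Finset.mul_sum, ← hR, ← hJ]
    exact sum_swap _
  have step : ∀ a b, γ * ((1 / 4 : ℝ) * ∑ s : Fin 4 → ZMod 2,
          ((Finset.univ.filter (fun μ : Fin 4 => s μ = 1)).card : ℝ) * ∑ μ, R s μ a b ^ 2 +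
        (1 / 4 : ℝ) * ∑ s : Fin 4 → ZMod 2,
          ((Finset.univ.filter (fun μ : Fin 4 => s μ = 1)).card : ℝ) * ∑ μ, J s μ a b ^ 2) ≤
      (1 / 256 : ℝ) * ∑ s, ∑ μ, ∑ ν, H s μ ν * (R s μ a b * R s ν a b + J s μ a b * J s ν a b) := by
    intro a b
    have hfin : ∀ s : Fin 4 → ZMod 2,
        64 * γ * (((Finset.univ.filter (fun μ : Fin 4 => s μ = 1)).card : ℝ) * ∑ μ, R s μ a b ^ 2) +
          64 * γ * (((Finset.univ.filter (fun μ : Fin 4 => s μ = 1)).card : ℝ) * ∑ μ, J s μ a b ^ 2) ≤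
        ∑ μ, ∑ ν, H s μ ν * (R s μ a b * R s ν a b + J s μ a b * J s ν a b) := by
      intro s
      have h1 := hblock s (fun μ => R s μ a b) (fun μ hμ => (auxR a b).1 s μ hμ) ((auxR a b).2.1 s)
      have h2 := hblock s (fun μ => J s μ a b) (fun μ hμ => (auxI a b).1 s μ hμ) ((auxI a b).2.1 s)
      simp only [mul_add, Finset.sum_add_distrib]
      exact add_le_add h1 h2
    calc _ = (1 / 256 : ℝ) * ∑ s : Fin 4 → ZMod 2,
          (64 * γ * (((Finset.univ.filter (fun μ : Fin 4 => s μ = 1)).card : ℝ) * ∑ μ, R s μ a b ^ 2) +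
            64 * γ * (((Finset.univ.filter (fun μ : Fin 4 => s μ = 1)).card : ℝ) * ∑ μ, J s μ a b ^ 2)) := by
          rw [Finset.sum_add_distrib, ← Finset.mul_sum, ← Finset.mul_sum]
          ring
      _ ≤ _ := mul_le_mul_of_nonneg_left (Finset.sum_le_sum fun s _ => hfin s) (by norm_num)
  rw [hK, hRJ]
  calc _ = ∑ a, ∑ b, γ * ((1 / 4 : ℝ) * ∑ s : Fin 4 → ZMod 2,
          ((Finset.univ.filter (fun μ : Fin 4 => s μ = 1)).card : ℝ) * ∑ μ, R s μ a b ^ 2 +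
        (1 / 4 : ℝ) * ∑ s : Fin 4 → ZMod 2,
          ((Finset.univ.filter (fun μ : Fin 4 => s μ = 1)).card : ℝ) * ∑ μ, J s μ a b ^ 2) := by
          simp only [Finset.mul_sum]
    _ ≤ ∑ a, ∑ b, (1 / 256 : ℝ) * ∑ s, ∑ μ, ∑ ν,
          H s μ ν * (R s μ a b * R s ν a b + J s μ a b * J s ν a b) :=
          Finset.sum_le_sum fun a _ => Finset.sum_le_sum fun b _ => step a b
    _ = (1 / 256 : ℝ) * ∑ a, ∑ b, ∑ s, ∑ μ, ∑ ν,
          H s μ ν * (R s μ a b * R s ν a b + J s μ a b * J s ν a b) := by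
          simp only [← Finset.mul_sum]
    _ = _ := by
          congr 1
          exact (Finset.sum_congr rfl fun _ _ => Finset.sum_comm).trans Finset.sum_comm

end Main

/-- **Sub-goal `stub_blockReductionAllN` — reduction of the block margin to momentum blocks, `N`
colours.**  On the `2⁴` block with constant central phases `u_μ = e^{iθ_μ}·1 ∈ U(N)`, `θ ∈ (0,π)⁴`,
`m = 0`, if every momentum block `H(s)` of the block-Hessian kernel satisfies
`64 γ n_s |y|² ≤ yᵀ H(s) y` for real `4`-vectors `y` supported on `{μ : s_μ = 1}` with `Σ y = 0`,
then `γ 𝒦(Y) ≤ Q(Y)` for every tiling-odd anti-Hermitian block link field `Y : Edge 4 2 → M_N(ℂ)`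
(`B0, Dl, Mw, h, S, V, mom, qv, H` given by their defining equations).  Proof: `BlockReduction.main`
with the Ward identity `stub_wardKernelAllN` at `m = 0`. -/
theorem stub_blockReductionAllN : ∀ (N : ℕ) (θ : Fin 4 → ℝ) (u : Fin 4 → Matrix.unitaryGroup (Fin N) ℂ), (∀ μ, 0 < θ μ ∧ θ μ < Real.pi) → (∀ μ, ((u μ : Matrix.unitaryGroup (Fin N) ℂ) : Matrix (Fin N) (Fin N) ℂ) = Complex.exp (↑(θ μ) * Complex.I) • (1 : Matrix (Fin N) (Fin N) ℂ)) → ∀ (B0 : Matrix (TorusSite 4 2 × Fin N × Fin 4) (TorusSite 4 2 × Fin N × Fin 4) ℂ) (Dl : (Edge 4 2 → Matrix (Fin N) (Fin N) ℂ) → Matrix (TorusSite 4 2 × Fin N × Fin 4) (TorusSite 4 2 × Fin N × Fin 4) ℂ) (Mw h : (Fin 4 → ℝ) → ℝ) (S : (Fin 4 → ℝ) → Matrix (Fin 4) (Fin 4) ℂ) (V : (Fin 4 → ℝ) → (Fin 4 → ℝ) → Fin 4 → Matrix (Fin 4) (Fin 4) ℂ) (mom qv : (Fin 4 → ZMod 2)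 → Fin 4 → ℝ) (H : (Fin 4 → ZMod 2) → Fin 4 → Fin 4 → ℝ), B0 = wilsonDirac (unitaryFundamentalRep (Fin N) ℂ) (fun e : Edge 4 2 => u e.2) 0 1 → (∀ E, Dl E = Matrix.of fun (p q : TorusSite 4 2 × Fin N × Fin 4) => -(1 / 2 : ℂ) * ∑ μ : Fin 4, ((if q.1 = Site.shift p.1 μ then ((1 : Matrix (Fin 4) (Fin 4) ℂ) - euclideanGamma μ) p.2.2 q.2.2 * (((u μ : Matrix.unitaryGroup (Fin N) ℂ) : Matrix (Fin N) (Fin N) ℂ) * E (p.1, μ)) p.2.1 q.2.1 else 0) + (if p.1 = Site.shift q.1 μ then ((1 : Matrix (Fin 4) (Fin 4) ℂ) + euclideanGamma μ) p.2.2 q.2.2 * (((u μ : Matrix.unitaryGroup (Fin N) ℂ) : Matrix (Fin N) (Fin N) ℂ) * E (q.1, μ))ᴴ p.2.1 q.2.1 else 0))) → (∀ P, Mw P = (0 : ℝ) + ∑ κ : Fin 4, (1 - Real.cos (P κ))) → (∀ P, h P = Mw P ^ 2 + ∑ κ : Fin 4, Real.sin (P κ) ^ 2) → (∀ P, S P =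 ((h P)⁻¹ : ℂ) • (((Mw P : ℝ) : ℂ) • (1 : Matrix (Fin 4) (Fin 4) ℂ) - Complex.I • ∑ κ : Fin 4, ((Real.sin (P κ) : ℝ) : ℂ) • euclideanGamma κ)) → (∀ P q μ, V P q μ = (-(1 / 2 : ℂ) * (Complex.exp (↑(P μ) * Complex.I) * Complex.I)) • ((1 : Matrix (Fin 4) (Fin 4) ℂ) - euclideanGamma μ) + (-(1 / 2 : ℂ) * (Complex.exp (-(↑(P μ + q μ) * Complex.I)) * (-Complex.I))) • ((1 : Matrix (Fin 4) (Fin 4) ℂ) + euclideanGamma μ)) → (∀ s κ, mom s κ = θ κ + Real.pi * ((s κ).val : ℝ)) → (∀ s κ, qv s κ = Real.pi * ((s κ).val : ℝ)) → (∀ s μ ν, H s μ ν = (if μ = ν then (1 / 2 : ℝ) * ∑ s' : Fin 4 → ZMod 2, 4 * (Real.sin (mom s' μ) ^ 2 - Mw (mom s') * Real.cos (mom s' μ)) / h (mom s') else 0) + (1 / 2 : ℝ) * (∑ s' : Fin 4 → ZMod 2, (S (mom s') * V (mom s' + qv s) (qv s) ν * S (mom s' + qv s) * V (mom s') (qv s)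 μ).trace).re) → ∀ γ : ℝ, (∀ (s : Fin 4 → ZMod 2) (y : Fin 4 → ℝ), (∀ μ, s μ = 0 → y μ = 0) → ∑ μ, y μ = 0 → 64 * γ * (((Finset.univ.filter (fun μ : Fin 4 => s μ = 1)).card : ℝ) * ∑ μ, y μ ^ 2) ≤ ∑ μ, ∑ ν, H s μ ν * (y μ * y ν)) → ∀ Y : Edge 4 2 → Matrix (Fin N) (Fin N) ℂ, (∀ e, (Y e)ᴴ = -Y e) → (∀ (x : TorusSite 4 2) (μ : Fin 4), Y (Site.shift x μ, μ) = -Y (x, μ)) → γ * (∑ p : Plaquette 4 2, ∑ a, ∑ b, ‖(Y (p.1, p.2.1.1) + Y (Site.shift p.1 p.2.1.1, p.2.1.2) - Y (Site.shift p.1 p.2.1.2, p.2.1.1) - Y (p.1, p.2.1.2)) a b‖ ^ 2) ≤ ((B0⁻¹ * Dl Y * (B0⁻¹ * Dl Y)).trace.re / 2 - (B0⁻¹ * Dl (fun e => Y e * Y e)).trace.re / 2) := by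
  intro N θ u hθ hu B0 Dl Mw h S V mom qv H hB0 hDl hMw hh hS hV hmom hqv hH γ hblock Y hY hodd
  -- the polarised Ward identity on this block (all `N`, `m = 0`)
  have hW : ∀ (Z : Edge 4 2 → Matrix (Fin N) (Fin N) ℂ) (lam : TorusSite 4 2 → Matrix (Fin N) (Fin N) ℂ),
      (∀ e, (Z e)ᴴ = -Z e) → (∀ x, (lam x)ᴴ = -lam x) →
        (B0⁻¹ * Dl Z * (B0⁻¹ * Dl (fun e => lam e.1 - lam (Site.shift e.1 e.2)))).trace.re =
          (B0⁻¹ * Dl (fun e => Z e * (lam e.1 - lam (Site.shift e.1 e.2)) +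
            (lam e.1 - lam (Site.shift e.1 e.2)) * Z e)).trace.re / 2 :=
    stub_wardKernelAllN N 0 θ u hu B0 Dl hB0 hDl
  exact main 0 θ u B0 Dl Mw h S V mom qv H (fun s x => (-1 : ℝ) ^ (∑ κ, (s κ).val * (x κ).val))
    (fun E s μ => ∑ x, (((-1 : ℝ) ^ (∑ κ, (s κ).val * (x κ).val) : ℝ) : ℂ) • E (x, μ)) hθ hu hB0
    hDl hMw hh hS hV hmom hqv hH (fun _ _ => rfl) (fun _ _ _ => rfl) hW γ hblock Y hY hodd

end Summit.QuantumFields.QCD.Cruxes.FlatCellOptimal.BlockReduction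

end
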